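import Summits.BirchSwinnertonDyer.Rank1Residual.X11a.VisibilityRecordsNoRam
import Summits.BirchSwinnertonDyer.Rank1Residual.X11a.VisibilityRecords7
import Summits.BirchSwinnertonDyer.Rank1Residual.X11a.VisibilityRecords12
import Summits.BirchSwinnertonDyer.Rank1Residual.X11a.VisibilityRecords13
import Summits.BirchSwinnertonDyer.Rank1Residual.X11a.VisibilityRecords14
import Summits.BirchSwinnertonDyer.Rank1Residual.X11b.MultiplicativeSurjectivity
import Summits.BirchSwinnertonDyer.Rank1Residual.X11b.CertificateCheckBridge
import Literature.NumberTheory.EllipticCurves.OrdinaryPrimesProofs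
import Literature.NumberTheory.EllipticCurves.LFunctionPrimeCoeff
import Literature.NumberTheory.DiophantineGeometry.LocalReduction
import HarnessLib

/-!
# Class X11a — per-pair VISIBILITY records with the CLASS ATOMS in the kernel, file 6
# (cell `bsd-print-x11a`, seat p4)

HONEST FRAMING (cells `b2b-bsdres` / `bsd-print-x11a`, verbatim): the goal is to DELETE the
COMBINATION-SHAPED residual classes of the Birch–Swinnerton-Dyer formula for ALL analytic-rank
`≤ 1` elliptic curves over `ℚ` — "full BSD formula for every rank `≤ 1` curve in class `C`"
assembled STRICTLY from published theorems — so that the rank-`≤ 1` remainder becomes exactly the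
CONSTRUCTION-SHAPED classes, which are TYPED (missing-input `Prop`s), NOT attempted. This is not
"finishing BSD". PER PAIR: theorems only, no definition, no named fact; nothing is booked by this
file and no class label changes (referee / planner).

## What

For every record `bsdp<p>_v<label>` of `X11a/VisibilityRecords1…32.lean` (94 rank-`0` X11-type
pairs of the x11a gen-9 census) this file discharges the displayed class binder `hX : ClassX11a W p`
IN THE KERNEL up to the analytic rank: `classX11a_c<label> : W = ⟨…⟩ → W.analyticRank = 0 →
ClassX11a W p` — `p ∥ N` from the integral model (`p ∣ Δ`, `p ∤ c₄`; Silverman VII.5.1 (b)),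
`E[p]` irreducible by a Frobenius witness (a good prime `ℓ` with `X² − a_ℓ X + ℓ` irreducible mod
`p`, `a_ℓ` from the kernel point count `countPoints`; Mazur 1978 Prop. 6.3 (1), tree
`hasIrreducibleModPGaloisRep_of_intModel_of_noroot`), and NO (ram) prime by `not_ram_of_intModel`
(`X11a/VisibilityRecordsNoRam.lean`: every prime of `Δ` is `p`, additive, or multiplicative with `p ∣ ord_ℓ Δ`) — and restates the
record as `bsdp<p>_a<label>` with `hr : W.analyticRank = 0` in place of `hX`, the image bit
`ρ̄_{E,p}` onto in the kernel wherever `E` is très ramifié at `p` (x11c's `ClassX11a.surj_of_not_dvd`).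
Displayed binders LEFT per record: `hr` (`r_an = 0`, Cremona `allbsd`), `hq`/`hv` (`#Ш_an = p²`),
`θ`/`hθ` (the `p`-congruence, Sturm two-engine, x11a g9), `hrank` (`rank F(ℚ) = 2`, Cremona),
and `hsurj` only at the peu ramifié rows.

References: [SilvermanAEC2009] VII.5.1; [Mazur1978] Prop. 6.3; [SerreInventiones1972] §2.4 Prop. 15;
[Wuthrich2014] Prop. 21; [CremonaMazur2000] §3; [Miller2011LMS] Def. 1.1; [Cremona2006];
`X11a/VisibilityRecords1.lean` (template); HOME `run/shared/lean/pub/bsd-print-x11a/P4-RECORDS-TABLE.md`.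
-/

set_option autoImplicit false

noncomputable section

open scoped Classical

open WeierstrassCurve Literature.NumberTheory.EllipticCurves
  Literature.NumberTheory.EllipticCurves.Rank1Residual
  Literature.NumberTheory.EllipticCurves.Rank1Residual.Typed
  Literature.NumberTheory.EllipticCurves.Rank1Residual.X11RankOneCertificates
  Literature.NumberTheory.EllipticCurves.Wuthrich2014
  NumberField IsDedekindDomain Rat.HeightOneSpectrum
  Summit.BirchSwinnertonDyer.BirchSwinnertonDyer.Rank1Residual.IntModel

namespace Summit.BirchSwinnertonDyer.Rank1Residual.X11a.VisibilityRecords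

/-! ### `208080ea1 @ 5` -/

/-- **`208080ea1 = [0, 0, 0, -27591408, -56085771357]` lies in class X11a at `5`, in the KERNEL up to `r_an = 0`**: `5 ∥ N`
(`5 ∣ Δ = ±2⁴·3⁹·5⁸·17⁹`, `5 ∤ c₄`: multiplicative, Silverman VII.5.1 (b)); `E[5]` irreducible by the
Frobenius witness `ℓ = 7` (`#Ẽ(𝔽_7) = 8`, `a_7 = 0`, `X² − a_7X + 7` has no root mod `5`;
Mazur 1978 Prop. 6.3 (1)); no (ram) prime (`2` additive; `3` additive; `5 = p`; `17` additive). Displayed: `hr` (`r_an = 0`, Cremona).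
[cite: SilvermanAEC2009, VII.5 Prop. 5.1] [cite: Mazur1978, §6 Prop. 6.3 (1) (p. 153)] [cite: Cremona2006, Table 1 (Cremona label 208080ea1)] -/
theorem classX11a_c208080ea1 (W : WeierstrassCurve ℚ) [W.IsElliptic] [W.IsGloballyMinimal] [Fact (Nat.Prime 5)]
    (hWeq : W = ⟨0, 0, 0, -27591408, -56085771357⟩) (hr : W.analyticRank = 0) : ClassX11a W 5 := by
  haveI : Fact (Nat.Prime 2) := ⟨Nat.prime_two⟩
  haveI : Fact (Nat.Prime 3) := ⟨Nat.prime_three⟩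
  haveI : Fact (Nat.Prime 7) := ⟨by norm_num⟩
  haveI : Fact (Nat.Prime 17) := ⟨by norm_num⟩
  have hI : integralModelInt W = ⟨0, 0, 0, -27591408, -56085771357⟩ := by
    subst hWeq; exact integralModelInt_eq_of_map_eq _ (map_mk_int 0 0 0 (-27591408) (-56085771357))
  have hmult : Mult W 5 :=
    hasMultiplicativeReductionAtPrime_of_intModel hI 5 (by decide +kernel) (by decide +kernel)
  have hirr : Irr W 5 := by
    have hc : Nat.card (((⟨0, 0, 0, -27591408, -56085771357⟩ : WeierstrassCurve ℤ).map
        (Int.castRingHom (ZMod 7))).toAffine.Point) = 8 := by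
      have h := X11b.natCard_point_eq_countPoints 0 0 0 (-27591408) (-56085771357) 7 (by norm_num)
        (by decide +kernel)
      have h' : countPoints [0, 0, 0, -27591408, -56085771357] 7 = 8 := by decide +kernel
      exact_mod_cast h.trans h'
    exact hasIrreducibleModPGaloisRep_of_intModel_of_noroot (hp := ⟨by norm_num⟩) (hℓ := ⟨by norm_num⟩)
      hI 5 7 (by norm_num) (by decide +kernel) hc (by decide)
  have hnram : ¬ Ram W 5 := not_ram_of_intModel hI 5 [2, 3, 5, 17] [4, 9, 8, 9]
    (by intro q hq; simp only [List.mem_cons, List.mem_nil_iff, or_false] at hq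
        rcases hq with rfl | rfl | rfl | rfl <;> norm_num) (by decide +kernel)
    (by intro ℓ hℓ; simp only [List.mem_cons, List.mem_nil_iff, or_false] at hℓ
        rcases hℓ with rfl | rfl | rfl | rfl
        · exact Or.inr (Or.inl (by decide +kernel))
        · exact Or.inr (Or.inl (by decide +kernel))
        · exact Or.inl rfl
        · exact Or.inr (Or.inl (by decide +kernel)))
  exact ⟨hr, by decide, hmult, hirr, hnram⟩

/-- **`208080ea1 @ 5`: `BSD(E,5)` with the class atoms in the kernel** — `bsdp5_v208080ea1`
(`X11a/VisibilityRecords7.lean`) with `hX` supplied by `classX11a_c208080ea1`; image bit in the kernel (très ramifié, `ClassX11a.surj_of_not_dvd`). Displayed binders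
left: `hr` (`r_an = 0`), `hq`/`hv` (`#Ш_an = 25`), `θ`/`hθ` (the `5`-congruence), `hrank` (`rank F(ℚ) = 2`).
PER PAIR; nothing booked. [cite: Wuthrich2014, Prop. 21 (p. 400)] [cite: CremonaMazur2000, §3 and Table 1]
[cite: Cremona2006, Table 1 (Cremona label 208080ea1)] -/
theorem bsdp5_a208080ea1 (hCT : exists_casselsTate_pairing (K := ℚ)) (hW : sha_dvd_analyticSha)
    (hGZK : rank_eq_analyticRank_of_analyticRank_le_one) (hmod : hasEntireLFunction_rat)
    (W : WeierstrassCurve ℚ) [W.IsElliptic] [W.IsGloballyMinimal] [Fact (Nat.Prime 5)]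
    (hWeq : W = ⟨0, 0, 0, -27591408, -56085771357⟩) (hr : W.analyticRank = 0)
    {q : ℚ} (hq : shaAn W = (q : ℂ)) (hv : padicValRat 5 q ≤ 2)
    (W' : WeierstrassCurve ℚ) (hW' : W' = ⟨0, 0, 0, -3213, 70227⟩) [W'.IsElliptic]
    (θ : geomTorsion W' ((5 : ℕ) : ℤ) ≃+ geomTorsion W ((5 : ℕ) : ℤ))
    (hθ : ∀ (σ : Field.absoluteGaloisGroup ℚ) (P : geomTorsion W' ((5 : ℕ) : ℤ)),
      θ (σ • P) = σ • θ P)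
    (hrank : 2 ≤ W'.mordellWeilRank) : BSDp W 5 := by
  have hX : ClassX11a W 5 := classX11a_c208080ea1 W hWeq hr
  have hsurj : Surj W 5 := ClassX11a.surj_of_not_dvd W 5 hX (by
    rw [minimalDiscriminantInt_eq (integralModelInt_eq_of_map_eq (W := W) _ (by rw [hWeq]; exact map_mk_int 0 0 0 (-27591408) (-56085771357))),
      padicValInt_eq_of_dvd_of_not_dvd 5 (e := 8) (by decide +kernel) (by decide +kernel)]
    decide)
  exact bsdp5_v208080ea1 hCT hW hGZK hmod W hWeq hX hsurj hq hv W' hW' θ hθ hrank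

/-! ### `208080ea2 @ 5` -/

/-- **`208080ea2 = [0, 0, 0, -442125783, -3578218541982]` lies in class X11a at `5`, in the KERNEL up to `r_an = 0`**: `5 ∥ N`
(`5 ∣ Δ = ±2⁸·3⁹·5⁴·17⁹`, `5 ∤ c₄`: multiplicative, Silverman VII.5.1 (b)); `E[5]` irreducible by the
Frobenius witness `ℓ = 7` (`#Ẽ(𝔽_7) = 8`, `a_7 = 0`, `X² − a_7X + 7` has no root mod `5`;
Mazur 1978 Prop. 6.3 (1)); no (ram) prime (`2` additive; `3` additive; `5 = p`; `17` additive). Displayed: `hr` (`r_an = 0`, Cremona).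
[cite: SilvermanAEC2009, VII.5 Prop. 5.1] [cite: Mazur1978, §6 Prop. 6.3 (1) (p. 153)] [cite: Cremona2006, Table 1 (Cremona label 208080ea2)] -/
theorem classX11a_c208080ea2 (W : WeierstrassCurve ℚ) [W.IsElliptic] [W.IsGloballyMinimal] [Fact (Nat.Prime 5)]
    (hWeq : W = ⟨0, 0, 0, -442125783, -3578218541982⟩) (hr : W.analyticRank = 0) : ClassX11a W 5 := by
  haveI : Fact (Nat.Prime 2) := ⟨Nat.prime_two⟩
  haveI : Fact (Nat.Prime 3) := ⟨Nat.prime_three⟩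
  haveI : Fact (Nat.Prime 7) := ⟨by norm_num⟩
  haveI : Fact (Nat.Prime 17) := ⟨by norm_num⟩
  have hI : integralModelInt W = ⟨0, 0, 0, -442125783, -3578218541982⟩ := by
    subst hWeq; exact integralModelInt_eq_of_map_eq _ (map_mk_int 0 0 0 (-442125783) (-3578218541982))
  have hmult : Mult W 5 :=
    hasMultiplicativeReductionAtPrime_of_intModel hI 5 (by decide +kernel) (by decide +kernel)
  have hirr : Irr W 5 := by
    have hc : Nat.card (((⟨0, 0, 0, -442125783, -3578218541982⟩ : WeierstrassCurve ℤ).map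
        (Int.castRingHom (ZMod 7))).toAffine.Point) = 8 := by
      have h := X11b.natCard_point_eq_countPoints 0 0 0 (-442125783) (-3578218541982) 7 (by norm_num)
        (by decide +kernel)
      have h' : countPoints [0, 0, 0, -442125783, -3578218541982] 7 = 8 := by decide +kernel
      exact_mod_cast h.trans h'
    exact hasIrreducibleModPGaloisRep_of_intModel_of_noroot (hp := ⟨by norm_num⟩) (hℓ := ⟨by norm_num⟩)
      hI 5 7 (by norm_num) (by decide +kernel) hc (by decide)
  have hnram : ¬ Ram W 5 := not_ram_of_intModel hI 5 [2, 3, 5, 17] [8, 9, 4, 9]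
    (by intro q hq; simp only [List.mem_cons, List.mem_nil_iff, or_false] at hq
        rcases hq with rfl | rfl | rfl | rfl <;> norm_num) (by decide +kernel)
    (by intro ℓ hℓ; simp only [List.mem_cons, List.mem_nil_iff, or_false] at hℓ
        rcases hℓ with rfl | rfl | rfl | rfl
        · exact Or.inr (Or.inl (by decide +kernel))
        · exact Or.inr (Or.inl (by decide +kernel))
        · exact Or.inl rfl
        · exact Or.inr (Or.inl (by decide +kernel)))
  exact ⟨hr, by decide, hmult, hirr, hnram⟩

/-- **`208080ea2 @ 5`: `BSD(E,5)` with the class atoms in the kernel** — `bsdp5_v208080ea2`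
(`X11a/VisibilityRecords7.lean`) with `hX` supplied by `classX11a_c208080ea2`; image bit in the kernel (très ramifié, `ClassX11a.surj_of_not_dvd`). Displayed binders
left: `hr` (`r_an = 0`), `hq`/`hv` (`#Ш_an = 25`), `θ`/`hθ` (the `5`-congruence), `hrank` (`rank F(ℚ) = 2`).
PER PAIR; nothing booked. [cite: Wuthrich2014, Prop. 21 (p. 400)] [cite: CremonaMazur2000, §3 and Table 1]
[cite: Cremona2006, Table 1 (Cremona label 208080ea2)] -/
theorem bsdp5_a208080ea2 (hCT : exists_casselsTate_pairing (K := ℚ)) (hW : sha_dvd_analyticSha)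
    (hGZK : rank_eq_analyticRank_of_analyticRank_le_one) (hmod : hasEntireLFunction_rat)
    (W : WeierstrassCurve ℚ) [W.IsElliptic] [W.IsGloballyMinimal] [Fact (Nat.Prime 5)]
    (hWeq : W = ⟨0, 0, 0, -442125783, -3578218541982⟩) (hr : W.analyticRank = 0)
    {q : ℚ} (hq : shaAn W = (q : ℂ)) (hv : padicValRat 5 q ≤ 2)
    (W' : WeierstrassCurve ℚ) (hW' : W' = ⟨0, 0, 0, -3213, 70227⟩) [W'.IsElliptic]
    (θ : geomTorsion W' ((5 : ℕ) : ℤ) ≃+ geomTorsion W ((5 : ℕ) : ℤ))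
    (hθ : ∀ (σ : Field.absoluteGaloisGroup ℚ) (P : geomTorsion W' ((5 : ℕ) : ℤ)),
      θ (σ • P) = σ • θ P)
    (hrank : 2 ≤ W'.mordellWeilRank) : BSDp W 5 := by
  have hX : ClassX11a W 5 := classX11a_c208080ea2 W hWeq hr
  have hsurj : Surj W 5 := ClassX11a.surj_of_not_dvd W 5 hX (by
    rw [minimalDiscriminantInt_eq (integralModelInt_eq_of_map_eq (W := W) _ (by rw [hWeq]; exact map_mk_int 0 0 0 (-442125783) (-3578218541982))),
      padicValInt_eq_of_dvd_of_not_dvd 5 (e := 4) (by decide +kernel) (by decide +kernel)]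
    decide)
  exact bsdp5_v208080ea2 hCT hW hGZK hmod W hWeq hX hsurj hq hv W' hW' θ hθ hrank

/-! ### `214245v1 @ 5` -/

/-- **`214245v1 = [0, 0, 1, 572456292, 10416732211563]` lies in class X11a at `5`, in the KERNEL up to `r_an = 0`**: `5 ∥ N`
(`5 ∣ Δ = ±3⁴·5¹⁷·23¹¹`, `5 ∤ c₄`: multiplicative, Silverman VII.5.1 (b)); `E[5]` irreducible by the
Frobenius witness `ℓ = 17` (`#Ẽ(𝔽_17) = 24`, `a_17 = -6`, `X² − a_17X + 17` has no root mod `5`;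
Mazur 1978 Prop. 6.3 (1)); no (ram) prime (`3` additive; `5 = p`; `23` additive). Displayed: `hr` (`r_an = 0`, Cremona).
[cite: SilvermanAEC2009, VII.5 Prop. 5.1] [cite: Mazur1978, §6 Prop. 6.3 (1) (p. 153)] [cite: Cremona2006, Table 1 (Cremona label 214245v1)] -/
theorem classX11a_c214245v1 (W : WeierstrassCurve ℚ) [W.IsElliptic] [W.IsGloballyMinimal] [Fact (Nat.Prime 5)]
    (hWeq : W = ⟨0, 0, 1, 572456292, 10416732211563⟩) (hr : W.analyticRank = 0) : ClassX11a W 5 := by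
  haveI : Fact (Nat.Prime 3) := ⟨Nat.prime_three⟩
  haveI : Fact (Nat.Prime 17) := ⟨by norm_num⟩
  haveI : Fact (Nat.Prime 23) := ⟨by norm_num⟩
  have hI : integralModelInt W = ⟨0, 0, 1, 572456292, 10416732211563⟩ := by
    subst hWeq; exact integralModelInt_eq_of_map_eq _ (map_mk_int 0 0 1 572456292 10416732211563)
  have hmult : Mult W 5 :=
    hasMultiplicativeReductionAtPrime_of_intModel hI 5 (by decide +kernel) (by decide +kernel)
  have hirr : Irr W 5 := by
    have hc : Nat.card (((⟨0, 0, 1, 572456292, 10416732211563⟩ : WeierstrassCurve ℤ).map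
        (Int.castRingHom (ZMod 17))).toAffine.Point) = 24 := by
      have h := X11b.natCard_point_eq_countPoints 0 0 1 572456292 10416732211563 17 (by norm_num)
        (by decide +kernel)
      have h' : countPoints [0, 0, 1, 572456292, 10416732211563] 17 = 24 := by decide +kernel
      exact_mod_cast h.trans h'
    exact hasIrreducibleModPGaloisRep_of_intModel_of_noroot (hp := ⟨by norm_num⟩) (hℓ := ⟨by norm_num⟩)
      hI 5 17 (by norm_num) (by decide +kernel) hc (by decide)
  have hnram : ¬ Ram W 5 := not_ram_of_intModel hI 5 [3, 5, 23] [4, 17, 11]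
    (by intro q hq; simp only [List.mem_cons, List.mem_nil_iff, or_false] at hq
        rcases hq with rfl | rfl | rfl <;> norm_num) (by decide +kernel)
    (by intro ℓ hℓ; simp only [List.mem_cons, List.mem_nil_iff, or_false] at hℓ
        rcases hℓ with rfl | rfl | rfl
        · exact Or.inr (Or.inl (by decide +kernel))
        · exact Or.inl rfl
        · exact Or.inr (Or.inl (by decide +kernel)))
  exact ⟨hr, by decide, hmult, hirr, hnram⟩

/-- **`214245v1 @ 5`: `BSD(E,5)` with the class atoms in the kernel** — `bsdp5_v214245v1`
(`X11a/VisibilityRecords12.lean`) with `hX` supplied by `classX11a_c214245v1`; image bit in the kernel (très ramifié, `ClassX11a.surj_of_not_dvd`). Displayed binders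
left: `hr` (`r_an = 0`), `hq`/`hv` (`#Ш_an = 25`), `θ`/`hθ` (the `5`-congruence), `hrank` (`rank F(ℚ) = 2`).
PER PAIR; nothing booked. [cite: Wuthrich2014, Prop. 21 (p. 400)] [cite: CremonaMazur2000, §3 and Table 1]
[cite: Cremona2006, Table 1 (Cremona label 214245v1)] -/
theorem bsdp5_a214245v1 (hCT : exists_casselsTate_pairing (K := ℚ)) (hW : sha_dvd_analyticSha)
    (hGZK : rank_eq_analyticRank_of_analyticRank_le_one) (hmod : hasEntireLFunction_rat)
    (W : WeierstrassCurve ℚ) [W.IsElliptic] [W.IsGloballyMinimal] [Fact (Nat.Prime 5)]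
    (hWeq : W = ⟨0, 0, 1, 572456292, 10416732211563⟩) (hr : W.analyticRank = 0)
    {q : ℚ} (hq : shaAn W = (q : ℂ)) (hv : padicValRat 5 q ≤ 2)
    (W' : WeierstrassCurve ℚ) (hW' : W' = ⟨0, 0, 1, -6348, -185547⟩) [W'.IsElliptic]
    (θ : geomTorsion W' ((5 : ℕ) : ℤ) ≃+ geomTorsion W ((5 : ℕ) : ℤ))
    (hθ : ∀ (σ : Field.absoluteGaloisGroup ℚ) (P : geomTorsion W' ((5 : ℕ) : ℤ)),
      θ (σ • P) = σ • θ P)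
    (hrank : 2 ≤ W'.mordellWeilRank) : BSDp W 5 := by
  have hX : ClassX11a W 5 := classX11a_c214245v1 W hWeq hr
  have hsurj : Surj W 5 := ClassX11a.surj_of_not_dvd W 5 hX (by
    rw [minimalDiscriminantInt_eq (integralModelInt_eq_of_map_eq (W := W) _ (by rw [hWeq]; exact map_mk_int 0 0 1 572456292 10416732211563)),
      padicValInt_eq_of_dvd_of_not_dvd 5 (e := 17) (by decide +kernel) (by decide +kernel)]
    decide)
  exact bsdp5_v214245v1 hCT hW hGZK hmod W hWeq hX hsurj hq hv W' hW' θ hθ hrank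

/-! ### `237160bx1 @ 5` -/

/-- **`237160bx1 = [0, 1, 0, -396533496, -3039360655696]` lies in class X11a at `5`, in the KERNEL up to `r_an = 0`**: `5 ∥ N`
(`5 ∣ Δ = ±2¹¹·5²·7⁸·11¹¹`, `5 ∤ c₄`: multiplicative, Silverman VII.5.1 (b)); `E[5]` irreducible by the
Frobenius witness `ℓ = 13` (`#Ẽ(𝔽_13) = 9`, `a_13 = 5`, `X² − a_13X + 13` has no root mod `5`;
Mazur 1978 Prop. 6.3 (1)); no (ram) prime (`2` additive; `5 = p`; `7` additive; `11` additive). Displayed: `hr` (`r_an = 0`, Cremona).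
[cite: SilvermanAEC2009, VII.5 Prop. 5.1] [cite: Mazur1978, §6 Prop. 6.3 (1) (p. 153)] [cite: Cremona2006, Table 1 (Cremona label 237160bx1)] -/
theorem classX11a_c237160bx1 (W : WeierstrassCurve ℚ) [W.IsElliptic] [W.IsGloballyMinimal] [Fact (Nat.Prime 5)]
    (hWeq : W = ⟨0, 1, 0, -396533496, -3039360655696⟩) (hr : W.analyticRank = 0) : ClassX11a W 5 := by
  haveI : Fact (Nat.Prime 2) := ⟨Nat.prime_two⟩
  haveI : Fact (Nat.Prime 7) := ⟨by norm_num⟩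
  haveI : Fact (Nat.Prime 11) := ⟨by norm_num⟩
  haveI : Fact (Nat.Prime 13) := ⟨by norm_num⟩
  have hI : integralModelInt W = ⟨0, 1, 0, -396533496, -3039360655696⟩ := by
    subst hWeq; exact integralModelInt_eq_of_map_eq _ (map_mk_int 0 1 0 (-396533496) (-3039360655696))
  have hmult : Mult W 5 :=
    hasMultiplicativeReductionAtPrime_of_intModel hI 5 (by decide +kernel) (by decide +kernel)
  have hirr : Irr W 5 := by
    have hc : Nat.card (((⟨0, 1, 0, -396533496, -3039360655696⟩ : WeierstrassCurve ℤ).map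
        (Int.castRingHom (ZMod 13))).toAffine.Point) = 9 := by
      have h := X11b.natCard_point_eq_countPoints 0 1 0 (-396533496) (-3039360655696) 13 (by norm_num)
        (by decide +kernel)
      have h' : countPoints [0, 1, 0, -396533496, -3039360655696] 13 = 9 := by decide +kernel
      exact_mod_cast h.trans h'
    exact hasIrreducibleModPGaloisRep_of_intModel_of_noroot (hp := ⟨by norm_num⟩) (hℓ := ⟨by norm_num⟩)
      hI 5 13 (by norm_num) (by decide +kernel) hc (by decide)
  have hnram : ¬ Ram W 5 := not_ram_of_intModel hI 5 [2, 5, 7, 11] [11, 2, 8, 11]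
    (by intro q hq; simp only [List.mem_cons, List.mem_nil_iff, or_false] at hq
        rcases hq with rfl | rfl | rfl | rfl <;> norm_num) (by decide +kernel)
    (by intro ℓ hℓ; simp only [List.mem_cons, List.mem_nil_iff, or_false] at hℓ
        rcases hℓ with rfl | rfl | rfl | rfl
        · exact Or.inr (Or.inl (by decide +kernel))
        · exact Or.inl rfl
        · exact Or.inr (Or.inl (by decide +kernel))
        · exact Or.inr (Or.inl (by decide +kernel)))
  exact ⟨hr, by decide, hmult, hirr, hnram⟩

/-- **`237160bx1 @ 5`: `BSD(E,5)` with the class atoms in the kernel** — `bsdp5_v237160bx1`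
(`X11a/VisibilityRecords13.lean`) with `hX` supplied by `classX11a_c237160bx1`; image bit in the kernel (très ramifié, `ClassX11a.surj_of_not_dvd`). Displayed binders
left: `hr` (`r_an = 0`), `hq`/`hv` (`#Ш_an = 25`), `θ`/`hθ` (the `5`-congruence), `hrank` (`rank F(ℚ) = 2`).
PER PAIR; nothing booked. [cite: Wuthrich2014, Prop. 21 (p. 400)] [cite: CremonaMazur2000, §3 and Table 1]
[cite: Cremona2006, Table 1 (Cremona label 237160bx1)] -/
theorem bsdp5_a237160bx1 (hCT : exists_casselsTate_pairing (K := ℚ)) (hW : sha_dvd_analyticSha)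
    (hGZK : rank_eq_analyticRank_of_analyticRank_le_one) (hmod : hasEntireLFunction_rat)
    (W : WeierstrassCurve ℚ) [W.IsElliptic] [W.IsGloballyMinimal] [Fact (Nat.Prime 5)]
    (hWeq : W = ⟨0, 1, 0, -396533496, -3039360655696⟩) (hr : W.analyticRank = 0)
    {q : ℚ} (hq : shaAn W = (q : ℂ)) (hv : padicValRat 5 q ≤ 2)
    (W' : WeierstrassCurve ℚ) (hW' : W' = ⟨0, 1, 0, -1976, 226400⟩) [W'.IsElliptic]
    (θ : geomTorsion W' ((5 : ℕ) : ℤ) ≃+ geomTorsion W ((5 : ℕ) : ℤ))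
    (hθ : ∀ (σ : Field.absoluteGaloisGroup ℚ) (P : geomTorsion W' ((5 : ℕ) : ℤ)),
      θ (σ • P) = σ • θ P)
    (hrank : 2 ≤ W'.mordellWeilRank) : BSDp W 5 := by
  have hX : ClassX11a W 5 := classX11a_c237160bx1 W hWeq hr
  have hsurj : Surj W 5 := ClassX11a.surj_of_not_dvd W 5 hX (by
    rw [minimalDiscriminantInt_eq (integralModelInt_eq_of_map_eq (W := W) _ (by rw [hWeq]; exact map_mk_int 0 1 0 (-396533496) (-3039360655696))),
      padicValInt_eq_of_dvd_of_not_dvd 5 (e := 2) (by decide +kernel) (by decide +kernel)]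
    decide)
  exact bsdp5_v237160bx1 hCT hW hGZK hmod W hWeq hX hsurj hq hv W' hW' θ hθ hrank

/-! ### `259920cz1 @ 5` -/

/-- **`259920cz1 = [0, 0, 0, -1261863948, -17252997538228]` lies in class X11a at `5`, in the KERNEL up to `r_an = 0`**: `5 ∥ N`
(`5 ∣ Δ = ±2⁸·3⁸·5¹¹·19⁸`, `5 ∤ c₄`: multiplicative, Silverman VII.5.1 (b)); `E[5]` irreducible by the
Frobenius witness `ℓ = 17` (`#Ẽ(𝔽_17) = 14`, `a_17 = 4`, `X² − a_17X + 17` has no root mod `5`;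
Mazur 1978 Prop. 6.3 (1)); no (ram) prime (`2` additive; `3` additive; `5 = p`; `19` additive). Displayed: `hr` (`r_an = 0`, Cremona).
[cite: SilvermanAEC2009, VII.5 Prop. 5.1] [cite: Mazur1978, §6 Prop. 6.3 (1) (p. 153)] [cite: Cremona2006, Table 1 (Cremona label 259920cz1)] -/
theorem classX11a_c259920cz1 (W : WeierstrassCurve ℚ) [W.IsElliptic] [W.IsGloballyMinimal] [Fact (Nat.Prime 5)]
    (hWeq : W = ⟨0, 0, 0, -1261863948, -17252997538228⟩) (hr : W.analyticRank = 0) : ClassX11a W 5 := by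
  haveI : Fact (Nat.Prime 2) := ⟨Nat.prime_two⟩
  haveI : Fact (Nat.Prime 3) := ⟨Nat.prime_three⟩
  haveI : Fact (Nat.Prime 17) := ⟨by norm_num⟩
  haveI : Fact (Nat.Prime 19) := ⟨by norm_num⟩
  have hI : integralModelInt W = ⟨0, 0, 0, -1261863948, -17252997538228⟩ := by
    subst hWeq; exact integralModelInt_eq_of_map_eq _ (map_mk_int 0 0 0 (-1261863948) (-17252997538228))
  have hmult : Mult W 5 :=
    hasMultiplicativeReductionAtPrime_of_intModel hI 5 (by decide +kernel) (by decide +kernel)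
  have hirr : Irr W 5 := by
    have hc : Nat.card (((⟨0, 0, 0, -1261863948, -17252997538228⟩ : WeierstrassCurve ℤ).map
        (Int.castRingHom (ZMod 17))).toAffine.Point) = 14 := by
      have h := X11b.natCard_point_eq_countPoints 0 0 0 (-1261863948) (-17252997538228) 17 (by norm_num)
        (by decide +kernel)
      have h' : countPoints [0, 0, 0, -1261863948, -17252997538228] 17 = 14 := by decide +kernel
      exact_mod_cast h.trans h'
    exact hasIrreducibleModPGaloisRep_of_intModel_of_noroot (hp := ⟨by norm_num⟩) (hℓ := ⟨by norm_num⟩)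
      hI 5 17 (by norm_num) (by decide +kernel) hc (by decide)
  have hnram : ¬ Ram W 5 := not_ram_of_intModel hI 5 [2, 3, 5, 19] [8, 8, 11, 8]
    (by intro q hq; simp only [List.mem_cons, List.mem_nil_iff, or_false] at hq
        rcases hq with rfl | rfl | rfl | rfl <;> norm_num) (by decide +kernel)
    (by intro ℓ hℓ; simp only [List.mem_cons, List.mem_nil_iff, or_false] at hℓ
        rcases hℓ with rfl | rfl | rfl | rfl
        · exact Or.inr (Or.inl (by decide +kernel))
        · exact Or.inr (Or.inl (by decide +kernel))
        · exact Or.inl rfl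
        · exact Or.inr (Or.inl (by decide +kernel)))
  exact ⟨hr, by decide, hmult, hirr, hnram⟩

/-- **`259920cz1 @ 5`: `BSD(E,5)` with the class atoms in the kernel** — `bsdp5_v259920cz1`
(`X11a/VisibilityRecords14.lean`) with `hX` supplied by `classX11a_c259920cz1`; image bit in the kernel (très ramifié, `ClassX11a.surj_of_not_dvd`). Displayed binders
left: `hr` (`r_an = 0`), `hq`/`hv` (`#Ш_an = 25`), `θ`/`hθ` (the `5`-congruence), `hrank` (`rank F(ℚ) = 2`).
PER PAIR; nothing booked. [cite: Wuthrich2014, Prop. 21 (p. 400)] [cite: CremonaMazur2000, §3 and Table 1]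
[cite: Cremona2006, Table 1 (Cremona label 259920cz1)] -/
theorem bsdp5_a259920cz1 (hCT : exists_casselsTate_pairing (K := ℚ)) (hW : sha_dvd_analyticSha)
    (hGZK : rank_eq_analyticRank_of_analyticRank_le_one) (hmod : hasEntireLFunction_rat)
    (W : WeierstrassCurve ℚ) [W.IsElliptic] [W.IsGloballyMinimal] [Fact (Nat.Prime 5)]
    (hWeq : W = ⟨0, 0, 0, -1261863948, -17252997538228⟩) (hr : W.analyticRank = 0)
    {q : ℚ} (hq : shaAn W = (q : ℂ)) (hv : padicValRat 5 q ≤ 2)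
    (W' : WeierstrassCurve ℚ) (hW' : W' = ⟨0, 0, 0, -1083, 130682⟩) [W'.IsElliptic]
    (θ : geomTorsion W' ((5 : ℕ) : ℤ) ≃+ geomTorsion W ((5 : ℕ) : ℤ))
    (hθ : ∀ (σ : Field.absoluteGaloisGroup ℚ) (P : geomTorsion W' ((5 : ℕ) : ℤ)),
      θ (σ • P) = σ • θ P)
    (hrank : 2 ≤ W'.mordellWeilRank) : BSDp W 5 := by
  have hX : ClassX11a W 5 := classX11a_c259920cz1 W hWeq hr
  have hsurj : Surj W 5 := ClassX11a.surj_of_not_dvd W 5 hX (by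
    rw [minimalDiscriminantInt_eq (integralModelInt_eq_of_map_eq (W := W) _ (by rw [hWeq]; exact map_mk_int 0 0 0 (-1261863948) (-17252997538228))),
      padicValInt_eq_of_dvd_of_not_dvd 5 (e := 11) (by decide +kernel) (by decide +kernel)]
    decide)
  exact bsdp5_v259920cz1 hCT hW hGZK hmod W hWeq hX hsurj hq hv W' hW' θ hθ hrank
end Summit.BirchSwinnertonDyer.Rank1Residual.X11a.VisibilityRecords

end
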